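import Literature.AlgebraicTopology.Homotopy.StrongDeformationRetract
import HarnessLib

/-!
# Absorbing a collar: gluing a strong deformation retraction to the identity

Topic `Literature/AlgebraicTopology/Homotopy`; companion to `StrongDeformationRetract.lean`
(`IsStrongDeformationRetractOf A S`: `A` is a strong deformation retract of `S`, for subsets of a
space `X`).

**The lemma.**  Let `P`, `C`, `F` be subsets of `X` such that `C` strong deformation retracts
onto `F` (`IsStrongDeformationRetractOf F C`), the overlap `P ∩ C` is fixed by the deformation
(`P ∩ C ⊆ F`), the retract lands in `P` (`F ∩ C ⊆ P`), and `P`, `C` are closed in `P ∪ C`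
(`closure P ∩ C ⊆ P`, `closure C ∩ P ⊆ C`).  Then `P` is a strong deformation retract of
`P ∪ C` (`IsStrongDeformationRetractOf.union_of_inter_subset`): run the deformation of `C` and
the identity of `P` simultaneously; they agree on `P ∩ C ⊆ F`, and the pasting lemma for two
relatively closed pieces gives continuity.

**The use** (`IsStrongDeformationRetractOf.union_of_isClosed`).  If `P`, `Q` are closed,
`P ∩ Q ⊆ F ⊆ P`, and `C ⊆ Q` is a neighbourhood of `F` in `Q` that strong deformation retracts
onto `F` — e.g. `P = H`, `Q = H'` the two handlebodies of a Heegaard splitting `H ∪_F H'` (or two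
sectors of a trisection meeting along a `3`-dimensional piece) and `C ≅ F × [0, 1)` an open collar
of `F = ∂H'` in `H'`, which retracts onto `F` along the collar lines — then `H` is a strong
deformation retract of the *thickening* `H ∪ C`, which is open in `H ∪ H'` when `C` is open in
`H'`.  This is how van Kampen's theorem for two OPEN sets
(`Literature/AlgebraicTopology/FundamentalGroup/VanKampenPushout.lean`, `VanKampenEpi.lean`) is
applied to decompositions into CLOSED pieces: the open thickenings have the fundamental groups of
the pieces (`DeformationRetractInclusion.lean`, Hatcher's Prop. 1.17).  Hatcher, *Algebraic
Topology* (2002), proof of Thm. 1.20's applications (Example 1.21 ff.: "open neighborhoods that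
deformation retract onto" the closed pieces) and Prop. 1.26's proof use exactly this device.

## References

* A. Hatcher, *Algebraic Topology*, CUP (2002), Ch. 0 (deformation retractions, p. 2) and §1.2
  (the open neighbourhoods `A_α` deformation retracting onto closed pieces in the applications of
  van Kampen's theorem). [HatcherAT2002]
-/

noncomputable section

open Set Function
open scoped unitInterval Topology

namespace Literature.AlgebraicTopology.Homotopy

namespace IsStrongDeformationRetractOf

variable {X : Type*} [TopologicalSpace X] {P Q C F : Set X}

/-- **Gluing a strong deformation retraction to the identity.**  If `C` strong deformation
retracts onto `F`, the overlap `P ∩ C` lies in `F` (so it is fixed by the deformation), the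
retract `F ∩ C` lies in `P`, and `P`, `C` are closed in `P ∪ C` (`closure P ∩ C ⊆ P`,
`closure C ∩ P ⊆ C`), then `P` is a strong deformation retract of `P ∪ C`: the deformation of
`C` and the identity of `P` paste to a deformation of `P ∪ C` into `P` fixing `P`. [folklore] -/
theorem union_of_inter_subset (h : IsStrongDeformationRetractOf F C) (hPC : P ∩ C ⊆ F)
    (hFP : F ∩ C ⊆ P) (hP : closure P ∩ C ⊆ P) (hC : closure C ∩ P ⊆ C) :
    IsStrongDeformationRetractOf P (P ∪ C) := by
  classical
  obtain ⟨H, h0, h1, hfix⟩ := h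
  -- the glued deformation, as a function on `I × X`
  let g : I × X → X := fun p => if hx : p.2 ∈ C then (H (p.1, ⟨p.2, hx⟩) : X) else p.2
  have hgC : ∀ (t : I) (x : X) (hx : x ∈ C), g (t, x) = H (t, ⟨x, hx⟩) := fun t x hx =>
    dif_pos hx
  have hgP : ∀ (t : I) (x : X), x ∈ P → g (t, x) = x := by
    intro t x hxP
    by_cases hx : x ∈ C
    · rw [hgC t x hx, hfix t ⟨x, hx⟩ (hPC ⟨hxP, hx⟩)]
    · exact dif_neg hx
  -- continuity on the two relatively closed pieces `I × P`, `I × C`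
  have hcC : ContinuousOn g (univ ×ˢ C) := by
    rw [continuousOn_iff_continuous_restrict]
    have hc : Continuous fun q : ↥(univ ×ˢ C) => (H (q.1.1, ⟨q.1.2, q.2.2⟩) : X) :=
      continuous_subtype_val.comp (H.continuous.comp
        ((continuous_fst.comp continuous_subtype_val).prodMk
          ((continuous_snd.comp continuous_subtype_val).subtype_mk _)))
    convert hc using 1
    ext q
    exact hgC q.1.1 q.1.2 q.2.2
  have hcP : ContinuousOn g (univ ×ˢ P) :=
    continuousOn_snd.congr fun q hq => hgP q.1 q.2 hq.2
  have hcont : ContinuousOn g (univ ×ˢ (P ∪ C)) := by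
    intro q hq
    rw [prod_union, continuousWithinAt_union]
    constructor
    · by_cases hqP : q.2 ∈ P
      · exact hcP q ⟨mem_univ _, hqP⟩
      · refine continuousWithinAt_of_notMem_closure fun hcl => hqP ?_
        have hq2 : q.2 ∈ closure P := by
          rw [closure_prod_eq, closure_univ] at hcl
          exact hcl.2
        rcases hq.2 with hq' | hq'
        · exact hq'
        · exact hP ⟨hq2, hq'⟩
    · by_cases hqC : q.2 ∈ C
      · exact hcC q ⟨mem_univ _, hqC⟩
      · refine continuousWithinAt_of_notMem_closure fun hcl => hqC ?_
        have hq2 : q.2 ∈ closure C := by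
          rw [closure_prod_eq, closure_univ] at hcl
          exact hcl.2
        rcases hq.2 with hq' | hq'
        · exact hC ⟨hq2, hq'⟩
        · exact hq'
  -- values stay in `P ∪ C`
  have hmaps : ∀ (t : I) (x : X), x ∈ P ∪ C → g (t, x) ∈ P ∪ C := by
    intro t x hx
    by_cases hxC : x ∈ C
    · rw [hgC t x hxC]
      exact Or.inr (H (t, ⟨x, hxC⟩)).2
    · rcases hx with hxP | hxC'
      · rw [hgP t x hxP]
        exact Or.inl hxP
      · exact absurd hxC' hxC
  refine ⟨⟨fun q => ⟨g (q.1, q.2), hmaps q.1 q.2 q.2.2⟩, ?_⟩, fun x => ?_, fun x => ?_,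
    fun t x hx => ?_⟩
  · exact (hcont.comp_continuous
      (continuous_fst.prodMk (continuous_subtype_val.comp continuous_snd))
      fun q => ⟨mem_univ _, q.2.2⟩).subtype_mk _
  · -- `t = 0`: the identity
    apply Subtype.ext
    show g (0, (x : X)) = x
    by_cases hxC : (x : X) ∈ C
    · rw [hgC 0 x hxC, h0]
    · exact dif_neg hxC
  · -- `t = 1`: lands in `P`
    show g (1, (x : X)) ∈ P
    by_cases hxC : (x : X) ∈ C
    · rw [hgC 1 x hxC]
      exact hFP ⟨h1 ⟨x, hxC⟩, (H (1, ⟨x, hxC⟩)).2⟩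
    · rcases x.2 with hxP | hxC'
      · show g (1, (x : X)) ∈ P
        rw [show g (1, (x : X)) = x from dif_neg hxC]
        exact hxP
      · exact absurd hxC' hxC
  · -- points of `P` are fixed
    apply Subtype.ext
    exact hgP t x hx

/-- **Absorbing a collar of the neighbouring piece.**  Let `P`, `Q` be closed subsets of `X`
meeting in `P ∩ Q ⊆ F ⊆ P`, and let `C ⊆ Q` contain `F` and strong deformation retract onto `F`
(a collar neighbourhood of `F` in `Q`, retracting along the collar lines).  Then `P` is a strong
deformation retract of the thickening `P ∪ C` of `P` — the device by which van Kampen's theorem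
for open covers is applied to a decomposition `P ∪ Q` into closed pieces (Hatcher, §1.2: open
neighbourhoods deformation retracting onto the closed pieces). [folklore] -/
theorem union_of_isClosed (h : IsStrongDeformationRetractOf F C) (hP : IsClosed P)
    (hQ : IsClosed Q) (hPQ : P ∩ Q ⊆ F) (hFP : F ⊆ P) (hFC : F ⊆ C) (hCQ : C ⊆ Q) :
    IsStrongDeformationRetractOf P (P ∪ C) :=
  union_of_inter_subset h (fun _ hx => hPQ ⟨hx.1, hCQ hx.2⟩) (fun _ hx => hFP hx.1)
    (fun _ hx => by rw [hP.closure_eq] at hx; exact hx.1)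
    (fun x hx => hFC (hPQ ⟨hx.2, hQ.closure_subset_iff.2 hCQ hx.1⟩))

end IsStrongDeformationRetractOf

end Literature.AlgebraicTopology.Homotopy

end
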